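import Summits.MatrixMultiplication.MatrixMultiplication.Theorems.ObstructionDescentUniversalOccurrenceTwoRectangleOddHookTableaux

set_option linter.dupNamespace false
set_option autoImplicit false

/-!
# Universal occurrence — two rectangles and the type `(2N-5,3,1,1)`, part A: the tableau (decomp-mm · lens 3 · gen 44)

Route `route-MatrixMultiplication-ObstructionDescent` (sub-problem `MatrixMultiplication`, `ω(ℂ) = 2`); SUPPORT for the crux
`NoOccurrenceObstruction` (`P_O`, item `stmt-MatrixMultiplication-29040`) through the universal-occurrence programme; the
combinatorial input of the SECOND FOUR-ODD FAMILY `((2^N),(2^N),(2N-5,3,1,1)) ∈ S(⟨m⟩)`, `m ≥ N + 2` (part D,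
`…TwoRectangleOddThree`).  No `def`, no `sorry`.

The tableau `T` of shape `(2N-5,3,1,1)` on the positions `[2N]`: the COLUMN `p ↦ (p,0)` for `p < 4`, the two DOMINOES
`4 ↦ (0,1), 5 ↦ (1,1)` and `6 ↦ (0,2), 7 ↦ (1,2)`, and the ARM `p ↦ (0, p-5)` for `p ≥ 8` (a standard filling for the position
order).  §1: cells, membership, standardness.  §2: the SUPPORT of the polytabloid `e_T` (a word `u` with `e_T(u) ≠ 0` vanishes
on the arm, reads four distinct letters `< 4` down the column and the two letters `{0,1}` down each domino) and its VALUE there: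
`e_T(u) = sgn(column reading) · (-1)^{u(4)} · (-1)^{u(6)}`, packaged as a parity (`oddThreeTableau_apply_eq_parity`).

[cite: BurgisserIkenmeyer2011, Thm. 4.4] [cite: BurgisserIkenmeyer2017, §5, Thm. 5.9 (proof of (2))] (polytabloids = highest
weight vectors of `V^{⊗d}`: folklore, e.g. Fulton, Young Tableaux, §7–8)
-/

noncomputable section

open scoped BigOperators

namespace Summit.MatrixMultiplication.MatrixMultiplication.Theorems.ObstructionCalculus

open Literature.Computability.AlgebraicComplexity
open Literature.NumberTheory.DiophantineGeometry

/-! ### §1 The tableau: column `0..3`, dominoes `4,5` and `6,7`, then the arm -/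

/-- Cells of the `(2N-5,3,1,1)` tableau are distinct. [folklore] -/
theorem oddThreeCell_injective {p q : ℕ}
    (hpq : (if p < 4 then (p, 0) else if p < 8 then (p % 2, p / 2 - 1) else (0, p - 5) : ℕ × ℕ) =
      (if q < 4 then (q, 0) else if q < 8 then (q % 2, q / 2 - 1) else (0, q - 5))) : p = q := by
  split_ifs at hpq <;> simp only [Prod.mk.injEq] at hpq <;> omega

/-- The `(2N-5,3,1,1)` tableau is a standard filling for the position order. [folklore] -/
theorem oddThreeCell_standard {p q : ℕ} (hpq : p < q) :
    ¬ ((if q < 4 then (q, 0) else if q < 8 then (q % 2, q / 2 - 1) else (0, q - 5) : ℕ × ℕ) ≤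
      (if p < 4 then (p, 0) else if p < 8 then (p % 2, p / 2 - 1) else (0, p - 5))) := by
  split_ifs <;> simp only [Prod.mk_le_mk] <;> omega

/-- The Young diagram of `(2N-5,3,1,1)`: its boxes. [folklore] -/
theorem mem_youngDiagram_oddThree {N : ℕ} (ν : Nat.Partition (N * 2)) (hν : ν.sortedParts = [2 * N - 5, 3, 1, 1])
    {r c : ℕ} (h : (r = 0 ∧ c < 2 * N - 5) ∨ (r = 1 ∧ c < 3) ∨ (2 ≤ r ∧ r < 4 ∧ c = 0)) : (r, c) ∈ ν.youngDiagram := by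
  rw [Nat.Partition.mem_youngDiagram_iff, hν]
  rcases h with ⟨rfl, hc⟩ | ⟨rfl, hc⟩ | ⟨hr2, hr4, rfl⟩
  · exact ⟨by simp, by simpa using hc⟩
  · exact ⟨by simp, by simpa using hc⟩
  · have hr : r = 2 ∨ r = 3 := by omega
    rcases hr with rfl | rfl <;> exact ⟨by simp, by simp⟩

/-- `(2N-5,3,1,1)` has four rows. [folklore] -/
theorem fst_lt_of_mem_youngDiagram_oddThree {N : ℕ} (ν : Nat.Partition (N * 2))
    (hν : ν.sortedParts = [2 * N - 5, 3, 1, 1]) {x : ℕ × ℕ} (hx : x ∈ ν.youngDiagram.cells) : x.1 < 4 := by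
  obtain ⟨h, -⟩ := (Nat.Partition.mem_youngDiagram_iff ν x).1 ((YoungDiagram.mem_cells _).1 hx)
  rw [hν] at h
  simpa using h

/-- The cells of the tableau lie in `(2N-5,3,1,1)` (`4 ≤ N`). [folklore] -/
theorem oddThreeCell_mem {N : ℕ} (hN : 4 ≤ N) (ν : Nat.Partition (N * 2)) (hν : ν.sortedParts = [2 * N - 5, 3, 1, 1])
    (p : ℕ) (hp : p < N * 2) :
    (if p < 4 then (p, 0) else if p < 8 then (p % 2, p / 2 - 1) else (0, p - 5) : ℕ × ℕ) ∈ ν.youngDiagram := by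
  split_ifs with h1 h2 <;> apply mem_youngDiagram_oddThree ν hν
  · have h : p = 0 ∨ p = 1 ∨ (2 ≤ p ∧ p < 4) := by omega
    rcases h with rfl | rfl | h
    · left; constructor <;> omega
    · right; left; constructor <;> omega
    · right; right; refine ⟨h.1, h.2, rfl⟩
  · have h : p % 2 = 0 ∨ p % 2 = 1 := by omega
    rcases h with h | h <;> rw [h]
    · left; constructor <;> omega
    · right; left; constructor <;> omega
  · left; constructor <;> omega

/-! ### §2 Support and value of the polytabloid `e_T` -/

/-- **Support of `e_T`.**  If `e_T(u) ≠ 0` then `u` vanishes on the arm, reads four distinct letters `< 4` down the column,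
and reads the two letters `0, 1` down each domino. [folklore] -/
theorem oddThreeTableau_support {N : ℕ} {Y : YoungDiagram} (hN : ∀ x ∈ Y.cells, x.1 < N) (T : StdFilling (N * 2) Y)
    (hT : ∀ p : Fin (N * 2), T.1 p =
      (if (p : ℕ) < 4 then ((p : ℕ), 0) else if (p : ℕ) < 8 then ((p : ℕ) % 2, (p : ℕ) / 2 - 1) else (0, (p : ℕ) - 5)))
    {u : Word N (N * 2)} (hu : T.polytabloid ℂ hN u ≠ 0) :
    (∀ p : Fin (N * 2), 8 ≤ (p : ℕ) → ((u p : Fin N) : ℕ) = 0) ∧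
    (∀ p : Fin (N * 2), (p : ℕ) < 4 → ((u p : Fin N) : ℕ) < 4) ∧
    (∀ p q : Fin (N * 2), (p : ℕ) < 4 → (q : ℕ) < 4 → u p = u q → p = q) ∧
    (∀ p : Fin (N * 2), 4 ≤ (p : ℕ) → (p : ℕ) < 8 → ((u p : Fin N) : ℕ) < 2) ∧
    (∀ p q : Fin (N * 2), 4 ≤ (p : ℕ) → (q : ℕ) < 8 → (q : ℕ) = (p : ℕ) + 1 → (p : ℕ) % 2 = 0 →
      ((u p : Fin N) : ℕ) + ((u q : Fin N) : ℕ) = 1) := by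
  classical
  obtain ⟨σ, hσ, rfl⟩ := StdFilling.exists_of_polytabloid_apply_ne_zero hN T hu
  have hcol : ∀ p, (T.1 (σ p)).2 = (T.1 p).2 := StdFilling.mem_colStab.1 hσ
  have hval : ∀ p, ((StdFilling.rowWord hN T ∘ ⇑σ) p : ℕ) = (T.1 (σ p)).1 := fun p => rfl
  have hrow' : ∀ q : Fin (N * 2), (T.1 q).1 =
      if (q : ℕ) < 4 then (q : ℕ) else if (q : ℕ) < 8 then (q : ℕ) % 2 else 0 := fun q => by
    rw [hT]; split_ifs <;> rfl
  have hcol' : ∀ q : Fin (N * 2), (T.1 q).2 =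
      if (q : ℕ) < 4 then 0 else if (q : ℕ) < 8 then (q : ℕ) / 2 - 1 else (q : ℕ) - 5 := fun q => by
    rw [hT]; split_ifs <;> rfl
  refine ⟨fun p hp => ?_, fun p hp => ?_, fun p q hp hq hpq => ?_, fun p hp hp' => ?_, fun p q hp hq hqp hp2 => ?_⟩
  · have hc := hcol p
    rw [hcol', hcol'] at hc
    rw [hval, hrow']
    split_ifs at hc ⊢ <;> omega
  · have hc := hcol p
    rw [hcol', hcol'] at hc
    rw [hval, hrow']
    split_ifs at hc ⊢ <;> omega
  · have hr : (T.1 (σ p)).1 = (T.1 (σ q)).1 := by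
      rw [← hval, ← hval]; exact congrArg Fin.val hpq
    have hc : (T.1 (σ p)).2 = (T.1 (σ q)).2 := by
      rw [hcol, hcol, hcol', hcol', if_pos hp, if_pos hq]
    exact σ.injective (T.injective (Prod.ext hr hc))
  · have hc := hcol p
    rw [hcol', hcol'] at hc
    rw [hval, hrow']
    split_ifs at hc ⊢ <;> omega
  · have hcp := hcol p
    have hcq := hcol q
    rw [hcol', hcol'] at hcp hcq
    have hne : ((σ p : Fin (N * 2)) : ℕ) ≠ ((σ q : Fin (N * 2)) : ℕ) := fun h =>
      absurd (congrArg Fin.val (σ.injective (Fin.ext h))) (by omega)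
    rw [hval, hval, hrow', hrow']
    split_ifs at hcp hcq ⊢ <;> omega

set_option maxHeartbeats 400000 in
/-- **Value of `e_T` on a support word.**  If `u` vanishes on the arm, `π ∈ S_4` reads the column and each domino reads
`{0,1}`, then `e_T(u) = sgn π · (-1)^{u 4} · (-1)^{u 6}`: `u = w_T ∘ ρ` for the column permutation
`ρ = π̃ · (4 q₁) · (6 q₂)` (`q₁ ∈ {4,5}`, `q₂ ∈ {6,7}` the domino cells carrying the letter `0`). [folklore] -/
theorem oddThreeTableau_apply_eq_sign {N : ℕ} {Y : YoungDiagram} (hN : ∀ x ∈ Y.cells, x.1 < N) (T : StdFilling (N * 2) Y)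
    (hT : ∀ p : Fin (N * 2), T.1 p =
      (if (p : ℕ) < 4 then ((p : ℕ), 0) else if (p : ℕ) < 8 then ((p : ℕ) % 2, (p : ℕ) / 2 - 1) else (0, (p : ℕ) - 5)))
    (h8 : 8 ≤ N * 2) {u : Word N (N * 2)} (harm : ∀ p : Fin (N * 2), 8 ≤ (p : ℕ) → ((u p : Fin N) : ℕ) = 0)
    (π : Equiv.Perm (Fin 4)) (hπ : ∀ i : Fin 4, ((π i : Fin 4) : ℕ) = ((u ⟨i, by omega⟩ : Fin N) : ℕ))
    (h45 : ((u ⟨4, by omega⟩ : Fin N) : ℕ) + ((u ⟨5, by omega⟩ : Fin N) : ℕ) = 1)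
    (h67 : ((u ⟨6, by omega⟩ : Fin N) : ℕ) + ((u ⟨7, by omega⟩ : Fin N) : ℕ) = 1) :
    T.polytabloid ℂ hN u = ((Equiv.Perm.sign π : ℤ) : ℂ) * (if ((u ⟨4, by omega⟩ : Fin N) : ℕ) = 0 then 1 else -1) *
      (if ((u ⟨6, by omega⟩ : Fin N) : ℕ) = 0 then 1 else -1) := by
  classical
  let f : Fin 4 ≃ {p : Fin (N * 2) // (p : ℕ) < 4} :=
    { toFun := fun i => ⟨⟨i, by omega⟩, i.2⟩
      invFun := fun p => ⟨p.1, p.2⟩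
      left_inv := fun i => Fin.ext rfl
      right_inv := fun p => Subtype.ext (Fin.ext rfl) }
  obtain ⟨E, hE⟩ : ∃ E : Equiv.Perm (Fin (N * 2)), E = π.extendDomain f := ⟨_, rfl⟩
  have hE_lt : ∀ (p : Fin (N * 2)) (hp : (p : ℕ) < 4), ((E p : Fin (N * 2)) : ℕ) = ((π ⟨p, hp⟩ : Fin 4) : ℕ) := by
    intro p hp
    rw [hE, Equiv.Perm.extendDomain_apply_subtype π f hp]
    rfl
  have hE_ge : ∀ p : Fin (N * 2), ¬ (p : ℕ) < 4 → E p = p := fun p hp => by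
    rw [hE]; exact Equiv.Perm.extendDomain_apply_not_subtype π f hp
  have hrow' : ∀ q : Fin (N * 2), (T.1 q).1 =
      if (q : ℕ) < 4 then (q : ℕ) else if (q : ℕ) < 8 then (q : ℕ) % 2 else 0 := fun q => by
    rw [hT]; split_ifs <;> rfl
  have hcol' : ∀ q : Fin (N * 2), (T.1 q).2 =
      if (q : ℕ) < 4 then 0 else if (q : ℕ) < 8 then (q : ℕ) / 2 - 1 else (q : ℕ) - 5 := fun q => by
    rw [hT]; split_ifs <;> rfl
  -- the domino cells
  obtain ⟨p4, hp4⟩ : ∃ p : Fin (N * 2), (p : ℕ) = 4 := ⟨⟨4, by omega⟩, rfl⟩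
  obtain ⟨p5, hp5⟩ : ∃ p : Fin (N * 2), (p : ℕ) = 5 := ⟨⟨5, by omega⟩, rfl⟩
  obtain ⟨p6, hp6⟩ : ∃ p : Fin (N * 2), (p : ℕ) = 6 := ⟨⟨6, by omega⟩, rfl⟩
  obtain ⟨p7, hp7⟩ : ∃ p : Fin (N * 2), (p : ℕ) = 7 := ⟨⟨7, by omega⟩, rfl⟩
  have hP4 : (⟨4, by omega⟩ : Fin (N * 2)) = p4 := Fin.ext (by rw [hp4])
  have hP5 : (⟨5, by omega⟩ : Fin (N * 2)) = p5 := Fin.ext (by rw [hp5])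
  have hP6 : (⟨6, by omega⟩ : Fin (N * 2)) = p6 := Fin.ext (by rw [hp6])
  have hP7 : (⟨7, by omega⟩ : Fin (N * 2)) = p7 := Fin.ext (by rw [hp7])
  rw [hP4, hP5] at h45
  rw [hP6, hP7] at h67
  rw [hP4, hP6]
  have hpne : ∀ {q q' : Fin (N * 2)}, (q : ℕ) ≠ (q' : ℕ) → q ≠ q' := fun h hqq' => h (congrArg Fin.val hqq')
  have hp45 : p4 ≠ p5 := hpne (by omega)
  have hp67 : p6 ≠ p7 := hpne (by omega)
  -- the column permutation `ρ = E · (p4 q1) · (p6 q2)`, `q1, q2` the domino cells carrying `0`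
  have key : ∀ q1 q2 : Fin (N * 2), ((q1 = p4 ∧ ((u p4 : Fin N) : ℕ) = 0) ∨ (q1 = p5 ∧ ((u p4 : Fin N) : ℕ) = 1)) →
      ((q2 = p6 ∧ ((u p6 : Fin N) : ℕ) = 0) ∨ (q2 = p7 ∧ ((u p6 : Fin N) : ℕ) = 1)) →
      T.polytabloid ℂ hN u = ((Equiv.Perm.sign π : ℤ) : ℂ) * ((Equiv.Perm.sign (Equiv.swap p4 q1) : ℤ) : ℂ) *
        ((Equiv.Perm.sign (Equiv.swap p6 q2) : ℤ) : ℂ) := by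
    intro q1 q2 h1 h2
    have hq1v : ((q1 : Fin (N * 2)) : ℕ) = 4 ∨ ((q1 : Fin (N * 2)) : ℕ) = 5 := by
      rcases h1 with ⟨h, -⟩ | ⟨h, -⟩ <;> rw [h] <;> omega
    have hq2v : ((q2 : Fin (N * 2)) : ℕ) = 6 ∨ ((q2 : Fin (N * 2)) : ℕ) = 7 := by
      rcases h2 with ⟨h, -⟩ | ⟨h, -⟩ <;> rw [h] <;> omega
    obtain ⟨ρ, hρ⟩ : ∃ ρ : Equiv.Perm (Fin (N * 2)), ρ = E * Equiv.swap p4 q1 * Equiv.swap p6 q2 := ⟨_, rfl⟩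
    have hEcol : E ∈ T.colStab := StdFilling.mem_colStab.2 fun p => by
      rw [hcol', hcol']
      by_cases hp : (p : ℕ) < 4
      · have h2' : ((E p : Fin (N * 2)) : ℕ) < 4 := by rw [hE_lt p hp]; exact (π ⟨p, hp⟩).2
        rw [if_pos h2', if_pos hp]
      · rw [hE_ge p hp]
    have hS1col : Equiv.swap p4 q1 ∈ T.colStab :=
      StdFilling.swap_mem_colStab (by rw [hcol', hcol']; split_ifs <;> omega)
    have hS2col : Equiv.swap p6 q2 ∈ T.colStab :=
      StdFilling.swap_mem_colStab (by rw [hcol', hcol']; split_ifs <;> omega)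
    have hρcol : ρ ∈ T.colStab := by
      rw [hρ]; exact StdFilling.mul_mem_colStab (StdFilling.mul_mem_colStab hEcol hS1col) hS2col
    have hρv : ∀ p : Fin (N * 2), ρ p = E (Equiv.swap p4 q1 (Equiv.swap p6 q2 p)) := fun p => by rw [hρ]; rfl
    have hu : u = T.rowWord hN ∘ ⇑ρ := by
      funext p
      apply Fin.ext
      show ((u p : Fin N) : ℕ) = (T.1 (ρ p)).1
      rw [hrow', hρv]
      have hv : (p : ℕ) < 4 ∨ p = p4 ∨ p = p5 ∨ p = p6 ∨ p = p7 ∨ 8 ≤ (p : ℕ) := by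
        have h : (p : ℕ) < 4 ∨ (p : ℕ) = 4 ∨ (p : ℕ) = 5 ∨ (p : ℕ) = 6 ∨ (p : ℕ) = 7 ∨ 8 ≤ (p : ℕ) := by omega
        rcases h with h | h | h | h | h | h
        · exact Or.inl h
        · exact Or.inr (Or.inl (Fin.ext (by rw [h, hp4])))
        · exact Or.inr (Or.inr (Or.inl (Fin.ext (by rw [h, hp5]))))
        · exact Or.inr (Or.inr (Or.inr (Or.inl (Fin.ext (by rw [h, hp6])))))
        · exact Or.inr (Or.inr (Or.inr (Or.inr (Or.inl (Fin.ext (by rw [h, hp7]))))))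
        · exact Or.inr (Or.inr (Or.inr (Or.inr (Or.inr h))))
      rcases hv with hp | hpp | hpp | hpp | hpp | hp
      · rw [Equiv.swap_apply_of_ne_of_ne (a := p6) (b := q2) (x := p) (hpne (by omega)) (hpne (by omega)),
          Equiv.swap_apply_of_ne_of_ne (a := p4) (b := q1) (x := p) (hpne (by omega)) (hpne (by omega))]
        have h1' := hE_lt p hp
        have h2' : ((E p : Fin (N * 2)) : ℕ) < 4 := by rw [h1']; exact (π ⟨p, hp⟩).2
        rw [if_pos h2', h1', hπ ⟨p, hp⟩]
      · rw [hpp, Equiv.swap_apply_of_ne_of_ne (a := p6) (b := q2) (x := p4) (hpne (by omega)) (hpne (by omega)),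
          Equiv.swap_apply_left, hE_ge q1 (by omega)]
        rcases h1 with ⟨h, hu4⟩ | ⟨h, hu4⟩ <;> rw [h] <;> split_ifs <;> omega
      · rw [hpp, Equiv.swap_apply_of_ne_of_ne (a := p6) (b := q2) (x := p5) (hpne (by omega)) (hpne (by omega))]
        rcases h1 with ⟨h, hu4⟩ | ⟨h, hu4⟩
        · rw [h, Equiv.swap_apply_of_ne_of_ne (a := p4) (b := p4) (x := p5) hp45.symm hp45.symm,
            hE_ge p5 (by omega)]
          split_ifs <;> omega
        · rw [h, Equiv.swap_apply_right, hE_ge p4 (by omega)]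
          split_ifs <;> omega
      · rw [hpp, Equiv.swap_apply_left,
          Equiv.swap_apply_of_ne_of_ne (a := p4) (b := q1) (x := q2) (hpne (by omega)) (hpne (by omega)),
          hE_ge q2 (by omega)]
        rcases h2 with ⟨h, hu6⟩ | ⟨h, hu6⟩ <;> rw [h] <;> split_ifs <;> omega
      · rcases h2 with ⟨h, hu6⟩ | ⟨h, hu6⟩
        · rw [hpp, h, Equiv.swap_apply_of_ne_of_ne (a := p6) (b := p6) (x := p7) hp67.symm hp67.symm,
            Equiv.swap_apply_of_ne_of_ne (a := p4) (b := q1) (x := p7) (hpne (by omega)) (hpne (by omega)),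
            hE_ge p7 (by omega)]
          split_ifs <;> omega
        · rw [hpp, h, Equiv.swap_apply_right,
            Equiv.swap_apply_of_ne_of_ne (a := p4) (b := q1) (x := p6) (hpne (by omega)) (hpne (by omega)),
            hE_ge p6 (by omega)]
          split_ifs <;> omega
      · rw [Equiv.swap_apply_of_ne_of_ne (a := p6) (b := q2) (x := p) (hpne (by omega)) (hpne (by omega)),
          Equiv.swap_apply_of_ne_of_ne (a := p4) (b := q1) (x := p) (hpne (by omega)) (hpne (by omega)),
          hE_ge p (by omega), harm p hp]
        split_ifs <;> omega
    have h := congrFun (StdFilling.wordPerm_polytabloid_of_mem_colStab (k := ℂ) hN T hρcol) (T.rowWord hN)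
    rw [wordPerm_apply, Pi.smul_apply, smul_eq_mul, StdFilling.polytabloid_apply_rowWord, mul_one] at h
    rw [hu, h, hρ, Equiv.Perm.sign_mul, Equiv.Perm.sign_mul, hE, Equiv.Perm.sign_extendDomain, Units.val_mul,
      Units.val_mul, Int.cast_mul, Int.cast_mul]
  have h4 : ((u p4 : Fin N) : ℕ) = 0 ∨ ((u p4 : Fin N) : ℕ) = 1 := by omega
  have h6 : ((u p6 : Fin N) : ℕ) = 0 ∨ ((u p6 : Fin N) : ℕ) = 1 := by omega
  rcases h4 with h4 | h4 <;> rcases h6 with h6 | h6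
  · rw [key p4 p6 (Or.inl ⟨rfl, h4⟩) (Or.inl ⟨rfl, h6⟩), Equiv.swap_self, Equiv.swap_self, if_pos h4, if_pos h6]
    simp
  · rw [key p4 p7 (Or.inl ⟨rfl, h4⟩) (Or.inr ⟨rfl, h6⟩), Equiv.swap_self, Equiv.Perm.sign_swap hp67, if_pos h4,
      if_neg (by omega)]
    simp
  · rw [key p5 p6 (Or.inr ⟨rfl, h4⟩) (Or.inl ⟨rfl, h6⟩), Equiv.swap_self, Equiv.Perm.sign_swap hp45, if_neg (by omega),
      if_pos h6]
    simp
  · rw [key p5 p7 (Or.inr ⟨rfl, h4⟩) (Or.inr ⟨rfl, h6⟩), Equiv.Perm.sign_swap hp45, Equiv.Perm.sign_swap hp67,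
      if_neg (by omega), if_neg (by omega)]
    simp

set_option maxHeartbeats 400000 in
/-- **Value of `e_T` on a support word, as a parity.**  `e_T(u) = (-1)^{#inversions of the column reading + u(4) + u(6)}`.
[folklore] -/
theorem oddThreeTableau_apply_eq_parity {N : ℕ} {Y : YoungDiagram} (hN : ∀ x ∈ Y.cells, x.1 < N)
    (T : StdFilling (N * 2) Y)
    (hT : ∀ p : Fin (N * 2), T.1 p =
      (if (p : ℕ) < 4 then ((p : ℕ), 0) else if (p : ℕ) < 8 then ((p : ℕ) % 2, (p : ℕ) / 2 - 1) else (0, (p : ℕ) - 5)))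
    (h8 : 8 ≤ N * 2) {u : Word N (N * 2)} (harm : ∀ p : Fin (N * 2), 8 ≤ (p : ℕ) → ((u p : Fin N) : ℕ) = 0)
    (hlt : ∀ p : Fin (N * 2), (p : ℕ) < 4 → ((u p : Fin N) : ℕ) < 4)
    (hinj : ∀ p q : Fin (N * 2), (p : ℕ) < 4 → (q : ℕ) < 4 → u p = u q → p = q)
    (h45 : ((u ⟨4, by omega⟩ : Fin N) : ℕ) + ((u ⟨5, by omega⟩ : Fin N) : ℕ) = 1)
    (h67 : ((u ⟨6, by omega⟩ : Fin N) : ℕ) + ((u ⟨7, by omega⟩ : Fin N) : ℕ) = 1) :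
    T.polytabloid ℂ hN u =
      if ((if ((u ⟨1, by omega⟩ : Fin N) : ℕ) < ((u ⟨0, by omega⟩ : Fin N) : ℕ) then 1 else 0) +
          (if ((u ⟨2, by omega⟩ : Fin N) : ℕ) < ((u ⟨0, by omega⟩ : Fin N) : ℕ) then 1 else 0) +
          (if ((u ⟨3, by omega⟩ : Fin N) : ℕ) < ((u ⟨0, by omega⟩ : Fin N) : ℕ) then 1 else 0) +
          (if ((u ⟨2, by omega⟩ : Fin N) : ℕ) < ((u ⟨1, by omega⟩ : Fin N) : ℕ) then 1 else 0) +
          (if ((u ⟨3, by omega⟩ : Fin N) : ℕ) < ((u ⟨1, by omega⟩ : Fin N) : ℕ) then 1 else 0) +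
          (if ((u ⟨3, by omega⟩ : Fin N) : ℕ) < ((u ⟨2, by omega⟩ : Fin N) : ℕ) then 1 else 0) +
          ((u ⟨4, by omega⟩ : Fin N) : ℕ) + ((u ⟨6, by omega⟩ : Fin N) : ℕ)) % 2 = 0
      then 1 else -1 := by
  classical
  let g : Fin 4 → Fin 4 := fun i => ⟨((u ⟨i, by omega⟩ : Fin N) : ℕ), hlt _ (by simp)⟩
  have hg : Function.Injective g := by
    intro i j hij
    have h1 : ((u ⟨i, by omega⟩ : Fin N) : ℕ) = ((u ⟨j, by omega⟩ : Fin N) : ℕ) := by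
      have h := Fin.ext_iff.1 hij
      exact h
    have h2 := hinj ⟨i, by omega⟩ ⟨j, by omega⟩ (by simp) (by simp) (Fin.ext h1)
    exact Fin.ext (by simpa using congrArg Fin.val h2)
  let π : Equiv.Perm (Fin 4) := Equiv.ofBijective g (Finite.injective_iff_bijective.1 hg)
  have hπ : ∀ i : Fin 4, ((π i : Fin 4) : ℕ) = ((u ⟨i, by omega⟩ : Fin N) : ℕ) := fun i => rfl
  have e0 : ((π 0 : Fin 4) : ℕ) = ((u ⟨0, by omega⟩ : Fin N) : ℕ) := rfl
  have e1 : ((π 1 : Fin 4) : ℕ) = ((u ⟨1, by omega⟩ : Fin N) : ℕ) := rfl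
  have e2 : ((π 2 : Fin 4) : ℕ) = ((u ⟨2, by omega⟩ : Fin N) : ℕ) := rfl
  have e3 : ((π 3 : Fin 4) : ℕ) = ((u ⟨3, by omega⟩ : Fin N) : ℕ) := rfl
  rw [oddThreeTableau_apply_eq_sign hN T hT h8 harm π hπ h45 h67, sign_perm_fin_four_eq π, e0, e1, e2, e3]
  generalize ((if ((u ⟨1, by omega⟩ : Fin N) : ℕ) < ((u ⟨0, by omega⟩ : Fin N) : ℕ) then 1 else 0) +
      (if ((u ⟨2, by omega⟩ : Fin N) : ℕ) < ((u ⟨0, by omega⟩ : Fin N) : ℕ) then 1 else 0) +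
      (if ((u ⟨3, by omega⟩ : Fin N) : ℕ) < ((u ⟨0, by omega⟩ : Fin N) : ℕ) then 1 else 0) +
      (if ((u ⟨2, by omega⟩ : Fin N) : ℕ) < ((u ⟨1, by omega⟩ : Fin N) : ℕ) then 1 else 0) +
      (if ((u ⟨3, by omega⟩ : Fin N) : ℕ) < ((u ⟨1, by omega⟩ : Fin N) : ℕ) then 1 else 0) +
      (if ((u ⟨3, by omega⟩ : Fin N) : ℕ) < ((u ⟨2, by omega⟩ : Fin N) : ℕ) then 1 else 0) : ℕ) = I
  have h4 : ((u ⟨4, by omega⟩ : Fin N) : ℕ) = 0 ∨ ((u ⟨4, by omega⟩ : Fin N) : ℕ) = 1 := by omega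
  have h6 : ((u ⟨6, by omega⟩ : Fin N) : ℕ) = 0 ∨ ((u ⟨6, by omega⟩ : Fin N) : ℕ) = 1 := by omega
  rcases h4 with h4 | h4 <;> rcases h6 with h6 | h6 <;> rw [h4, h6] <;>
    by_cases hI : I % 2 = 0 <;> simp only [hI, if_true, if_false] <;> split_ifs <;> first | (exfalso; omega) | norm_num

end Summit.MatrixMultiplication.MatrixMultiplication.Theorems.ObstructionCalculus

end
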